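import Mathlib
import HarnessLib

/-!
# Route `RadicialJung`, crux `CleanModels` (stmt-ResolutionOfSingularities-15917), line `Sketch` rev 35, stub 6 `stub_cleanProp44` (X44c),
# `τ = 1` residual, (B5″): A STRAIGHT CHAIN OF MAXIMAL-CONTACT BIRTHS IS INFINITE IFF THE LEAF AXIS LIES IN `Σ_μ` (combinatorial core)

Seat decomp-res-hand-2 g12 (structural hand); fifth brick.  After ✓ `…BirthDescent` / `…BirthCorner` / `…BirthCornerSeparable` / `…BirthDerivation` the births
termination (B′) of memo `Cruxes/CleanModels/Lines/Sketch-memo-4e-cleanPermissible.md` §2.5–2.6 is reduced, for EVERY residue field, to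
(B5″): «no infinite unbranched chain of maximal-contact rational steps with constant `δ* = δ`» (memo `Lines/Sketch-memo-hand2-g12-stubs-5-7.md` §0).
This file kernel-checks the exponent bookkeeping of such a chain when it is STRAIGHT (no re-centring `u₂ ↦ u₂ − αu₁` and no re-preparation of the
leaf between generations) — the analogue, for birth chains, of ✓ `…CornerChains.lean` (`forall_cornerNear_replicate_iff`: near at every level iff the
double curve lies in `Σ_μ`).  NO scheme theory; the dictionary below is NOT formalized and nothing here closes stub 6.

DICTIONARY (informal; memo 4e §2.5 «THE TOWER»).  At the birth `c`: r.s.p. `(t, u₁, u₂)`, leaf `L = V(t)`, `δ = δ(c, L) ∈ pℤ`, maximal-contact normal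
form (✓ `births_corner_normalForm`: δ-face `C_μ(T + θU₂^δ)^μ` after re-preparation and re-centring).  One generation = blow up `c`, then the σ-tower
`Z₀, …, Z_{δ−2}` (all in the chart `u₁`), i.e. the substitution `t = t'u₁^δ`, `u₂ = u₂'u₁` with controlled transform `u₁^{−μδ}`: on the exponent
`(e, a, b)` of a monomial `t^e u₁^a u₂^b` (`e < μ`) this is the map `(e, a, b) ↦ (e, a + b − δ(μ − e), b)` (`δe + a + b − μδ = a + b − δ(μ − e)`), and the
next point `c'` is the origin of `(t', u₁, u₂')`, with the same leaf `V(t')` and the same shape.  The generation is POSSIBLE («near with `δ_k ≥ δ`»)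
iff every monomial of `J_k` has `a_k + b ≥ δ(μ − e)`.  In closed form (`births_chain_iterate_add`): `a_k = a + k·b − k·δ(μ − e)`, so generation `k` is
possible iff `a + (k+1)b ≥ (k+1)δ(μ − e)` for all monomials — this closed form is what the theorems below are about.

RESULTS.
* `births_chain_iterate_fst/snd_snd/iterate_add` — the iterate of the generation map: `e`, `b` fixed, `a_k + kδ(μ−e) = a + kb` while the chain is near.
* `births_chain_forall_iff` — **a straight chain is near at EVERY generation iff every monomial has `b ≥ δ(μ − e)`**, i.e. iff `J ⊆ Σ_e t^e (u₂)^{δ(μ−e)}`;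
  then (`births_chain_axis_mem`, `δ ≥ 1`) `e + b ≥ μ` for every monomial: `J ⊆ (t, u₂)^μ` — THE LEAF AXIS `𝒜 = V(t, u₂)` LIES IN `Σ_μ` (an `o = 1` curve of
  the stratum through `c`, which the O-strategy blows up before inserting at `c`: the memo's «dissolution», §2.6 (d)).
* `births_chain_length_le` — otherwise the chain is FINITE with the explicit bound `(k + 1)·(δ(μ − e) − b) ≤ a` from any witness monomial with `b < δ(μ − e)`.

What is NOT here: that an infinite chain can be made straight in suitable (formal) coordinates `(t̂, û₂)` (accumulated re-centrings/re-preparations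
converge `𝔪`-adically), and the algebraization of the formal axis (excellence, `dim Σ_μ ≤ 1`) — memo hand2-g12 §4 (c).  Honest framing: OURS, elementary
arithmetic; nothing here proves (B5″), X44c, any case of `CleanModels`, or resolution of singularities in characteristic `p`.
[cite: CossartPiltant2008, Lemma 4.3 (2) (5), Prop. 4.4 (p. 11)] [cite: CossartJannsenSaito2020, Lemma 6.30, Rem. 6.29].
-/

set_option linter.dupNamespace false -- mandated namespace of this single-conjunct summit

namespace Summit.ResolutionOfSingularities.ResolutionOfSingularities.Theorems.RadicialJung.CleanModels

/-! ## §1 The generation map on exponents and its iterates -/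

/-- The generation map fixes the `t`-exponent `e`. [folklore] -/
theorem births_chain_iterate_fst (δ μ k : ℕ) (m : ℕ × ℕ × ℕ) :
    ((fun m : ℕ × ℕ × ℕ => (m.1, m.2.1 + m.2.2 - δ * (μ - m.1), m.2.2))^[k] m).1 = m.1 := by
  induction k with
  | zero => rfl
  | succ k ih => rw [Function.iterate_succ_apply']; exact ih

/-- The generation map fixes the `u₂`-exponent `b`. [folklore] -/
theorem births_chain_iterate_snd_snd (δ μ k : ℕ) (m : ℕ × ℕ × ℕ) :
    ((fun m : ℕ × ℕ × ℕ => (m.1, m.2.1 + m.2.2 - δ * (μ - m.1), m.2.2))^[k] m).2.2 = m.2.2 := by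
  induction k with
  | zero => rfl
  | succ k ih => rw [Function.iterate_succ_apply']; exact ih

/-- **Closed form of the `u₁`-exponent along a near chain**: if the generations `j < k` were all possible for the monomial `(e, a, b)` (no truncated
subtraction: `δ(μ − e) ≤ a_j + b`), then `a_k + k·δ(μ − e) = a + k·b`. [folklore] -/
theorem births_chain_iterate_add (δ μ : ℕ) (m : ℕ × ℕ × ℕ) :
    ∀ k : ℕ, (∀ j < k, δ * (μ - m.1) ≤
        ((fun m : ℕ × ℕ × ℕ => (m.1, m.2.1 + m.2.2 - δ * (μ - m.1), m.2.2))^[j] m).2.1 + m.2.2) →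
      ((fun m : ℕ × ℕ × ℕ => (m.1, m.2.1 + m.2.2 - δ * (μ - m.1), m.2.2))^[k] m).2.1 + k * (δ * (μ - m.1)) =
        m.2.1 + k * m.2.2 := by
  intro k
  induction k with
  | zero => intro _; simp
  | succ k ih =>
    intro hnear
    have ih' := ih fun j hj => hnear j (Nat.lt_succ_of_lt hj)
    have hk := hnear k (Nat.lt_succ_self k)
    have he := births_chain_iterate_fst δ μ k m
    have hb := births_chain_iterate_snd_snd δ μ k m
    rw [Function.iterate_succ_apply']
    set q := (fun m : ℕ × ℕ × ℕ => (m.1, m.2.1 + m.2.2 - δ * (μ - m.1), m.2.2))^[k] m with hq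
    simp only at he hb hk ih' ⊢
    rw [he, hb] at *
    have hk' : δ * (μ - m.1) ≤ q.2.1 + m.2.2 := hk
    zify [hk'] at ih' ⊢
    linarith

/-! ## §2 Near at every generation iff the leaf axis lies in the stratum -/

/-- One monomial, closed form: `(∀ k, (k+1)·δ(μ−e) ≤ a + (k+1)·b) ↔ δ(μ−e) ≤ b`. [folklore] -/
theorem births_chain_forall_iff_one {D a b : ℕ} : (∀ k : ℕ, (k + 1) * D ≤ a + (k + 1) * b) ↔ D ≤ b := by
  constructor
  · intro h
    by_contra hlt
    push Not at hlt
    have ha := h a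
    -- `(a+1) D ≤ a + (a+1) b` with `b + 1 ≤ D` is absurd
    have : (a + 1) * (b + 1) ≤ (a + 1) * D := Nat.mul_le_mul_left _ hlt
    nlinarith
  · intro h k
    calc (k + 1) * D ≤ (k + 1) * b := Nat.mul_le_mul_left _ h
      _ ≤ a + (k + 1) * b := Nat.le_add_left _ _

/-- **A STRAIGHT CHAIN OF MAXIMAL-CONTACT STEPS IS NEAR AT EVERY GENERATION IFF EVERY MONOMIAL HAS `b ≥ δ(μ − e)`** (for the exponent set `N` of `J`
in the adapted coordinates; monomials with `e ≥ μ` impose nothing). [folklore] -/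
theorem births_chain_forall_iff (δ μ : ℕ) (N : Finset (ℕ × ℕ × ℕ)) :
    (∀ k : ℕ, ∀ m ∈ N, m.1 < μ → (k + 1) * (δ * (μ - m.1)) ≤ m.2.1 + (k + 1) * m.2.2) ↔
      ∀ m ∈ N, m.1 < μ → δ * (μ - m.1) ≤ m.2.2 := by
  constructor
  · intro h m hm he
    exact births_chain_forall_iff_one.mp fun k => h k m hm he
  · intro h k m hm he
    exact births_chain_forall_iff_one.mpr (h m hm he) k

/-- The closed form IS the chain: under the hypothesis of `births_chain_forall_iff` (right-hand side) every generation of the iterated exponent map is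
possible, `δ(μ − e) ≤ a_k + b` for all `k`. [folklore] -/
theorem births_chain_iterate_near_of_le (δ μ : ℕ) (m : ℕ × ℕ × ℕ) (h : δ * (μ - m.1) ≤ m.2.2) (k : ℕ) :
    δ * (μ - m.1) ≤ ((fun m : ℕ × ℕ × ℕ => (m.1, m.2.1 + m.2.2 - δ * (μ - m.1), m.2.2))^[k] m).2.1 + m.2.2 :=
  h.trans (Nat.le_add_left _ _)

/-- Conversely, if every generation of the iterated map is possible for the monomial `m`, then `δ(μ − e) ≤ b`. [folklore] -/
theorem births_chain_le_of_forall_iterate_near (δ μ : ℕ) (m : ℕ × ℕ × ℕ)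
    (h : ∀ k : ℕ, δ * (μ - m.1) ≤ ((fun m : ℕ × ℕ × ℕ => (m.1, m.2.1 + m.2.2 - δ * (μ - m.1), m.2.2))^[k] m).2.1 + m.2.2) :
    δ * (μ - m.1) ≤ m.2.2 := by
  refine (births_chain_forall_iff_one (a := m.2.1)).mp fun k => ?_
  have hclosed := births_chain_iterate_add δ μ m k fun j _ => h j
  have hk := h k
  -- `a_k + k D = a + k b` and `D ≤ a_k + b` give `(k+1) D ≤ a + (k+1) b`
  set ak := ((fun m : ℕ × ℕ × ℕ => (m.1, m.2.1 + m.2.2 - δ * (μ - m.1), m.2.2))^[k] m).2.1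
  nlinarith

/-- **THE LEAF AXIS LIES IN THE STRATUM**: with `1 ≤ δ`, `b ≥ δ(μ − e)` for `e < μ` gives `μ ≤ e + b` — every monomial of `J` lies in `(t, u₂)^μ`, i.e.
`𝒜 = V(t, u₂) ⊆ Σ_μ`. [folklore] -/
theorem births_chain_axis_mem (δ μ : ℕ) (hδ : 1 ≤ δ) (N : Finset (ℕ × ℕ × ℕ))
    (h : ∀ m ∈ N, m.1 < μ → δ * (μ - m.1) ≤ m.2.2) : ∀ m ∈ N, μ ≤ m.1 + m.2.2 := by
  intro m hm
  rcases lt_or_ge m.1 μ with he | he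
  · have hb := h m hm he
    have : μ - m.1 ≤ δ * (μ - m.1) := Nat.le_mul_of_pos_left _ hδ
    omega
  · omega

/-! ## §3 Otherwise the straight chain is finite, with an explicit bound -/

/-- **LENGTH BOUND**: if generation `k` is possible (`(k+1)·δ(μ−e) ≤ a + (k+1)·b` for every monomial) and some monomial has `b < δ(μ − e)`, then
`(k + 1)·(δ(μ − e) − b) ≤ a` for that monomial — the straight chain has at most `a / (δ(μ−e) − b)` generations. [folklore] -/
theorem births_chain_length_le {δ μ k : ℕ} {N : Finset (ℕ × ℕ × ℕ)}
    (hk : ∀ m ∈ N, m.1 < μ → (k + 1) * (δ * (μ - m.1)) ≤ m.2.1 + (k + 1) * m.2.2)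
    {m : ℕ × ℕ × ℕ} (hm : m ∈ N) (he : m.1 < μ) (hb : m.2.2 < δ * (μ - m.1)) :
    (k + 1) * (δ * (μ - m.1) - m.2.2) ≤ m.2.1 := by
  have h := hk m hm he
  have hsplit : (k + 1) * (δ * (μ - m.1)) = (k + 1) * (δ * (μ - m.1) - m.2.2) + (k + 1) * m.2.2 := by
    rw [← Nat.mul_add, Nat.sub_add_cancel hb.le]
  omega

/-- The same bound read off the iterated exponent map: if the generations `0, …, k` are all possible for the monomial `m` with `b < δ(μ − e)`, then
`(k + 1)·(δ(μ − e) − b) ≤ a`. [folklore] -/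
theorem births_chain_length_le_of_iterate {δ μ k : ℕ} (m : ℕ × ℕ × ℕ)
    (h : ∀ j ≤ k, δ * (μ - m.1) ≤ ((fun m : ℕ × ℕ × ℕ => (m.1, m.2.1 + m.2.2 - δ * (μ - m.1), m.2.2))^[j] m).2.1 + m.2.2)
    (hb : m.2.2 < δ * (μ - m.1)) : (k + 1) * (δ * (μ - m.1) - m.2.2) ≤ m.2.1 := by
  have hclosed := births_chain_iterate_add δ μ m k fun j hj => h j hj.le
  have hk := h k le_rfl
  set ak := ((fun m : ℕ × ℕ × ℕ => (m.1, m.2.1 + m.2.2 - δ * (μ - m.1), m.2.2))^[k] m).2.1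
  have hsplit : (k + 1) * (δ * (μ - m.1)) = (k + 1) * (δ * (μ - m.1) - m.2.2) + (k + 1) * m.2.2 := by
    rw [← Nat.mul_add, Nat.sub_add_cancel hb.le]
  nlinarith

end Summit.ResolutionOfSingularities.ResolutionOfSingularities.Theorems.RadicialJung.CleanModels
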